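import Summits.BirchSwinnertonDyer.BirchSwinnertonDyer.Theses.UniversalToricDescent
import Summits.BirchSwinnertonDyer.BirchSwinnertonDyer.Theorems.UniversalToricDescentTwinAlgMuZeroAtThreeOfBetaRoadParam
import Summits.BirchSwinnertonDyer.BirchSwinnertonDyer.Theorems.UniversalToricDescentTwinAlgMuZeroAtThreeOfBuckets
import Summits.BirchSwinnertonDyer.BirchSwinnertonDyer.Theorems.UniversalToricDescentAcDualMuZeroCriterion
import Literature.NumberTheory.EllipticCurves.Rubin1991.TwoVariableMainConjecture
import HarnessLib

/-!
# Crux 24737 `TwinAlgMuZeroAtThree` — NODE `steinberg_line_descent` (crux-ideate g6, idea `steinberg-line-descent`)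

D-0171 node for `stmt-BirchSwinnertonDyer-24737` (NOT registered; the registered skeleton of record stays `Lines/beta_road.lean` v19,
sha16 `4b5d40f4a458397e`).  Companion cards: `Ideas/steinberg-line-descent.md` (crux idea), `Lines/steinberg_line_descent.md` (node card).

THESIS OF THE LINE (bucket B = multiplicative très ramifié twins `E′`, `3 ∥ N′`, `a₃(E′) = ±1`, hence `3`-ORDINARY; `f_{E′}` is the
weight-2 STEINBERG point `𝔓` of the Hida family `𝐟` of TAME level `M = N′/3`, `3 ∤ M`).  Every printed anticyclotomic input the line of record
needs for `E′` itself (Howard 2004 Kolyvagin systems, Castella–Hsieh, BCK) is printed under `p ∤ N` and is OUT OF SCOPE at `3 ∣ N′` (audit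
g53: «K2a‴ is Howard's machine at `p ∥ N`, outside print»).  In the Hida family the level hypothesis bears on the TAME level only (`p ∤ M`,
Howard 2007 Hyp. 1.0.1, Fouquet 2013 §1, Castella 2020 §1), and the Steinberg point is an interior arithmetic point.  So: run the whole
machine ONE DIMENSION UP, over `R_Iw = 𝕀⟦Γ^ac⟧` (big Heegner points `𝔷_∞`, Fouquet's two-variable Howard divisibility
`char H̃²_tors ∣ char(H̃¹/𝔷_∞)²`, Castella's two-variable explicit reciprocity law `Log(loc_𝔭 𝔷_∞) = 𝓛_{𝔭,ξ}(𝐟)` proved at the DENSE set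
of weight-2 points with non-trivial wild nebentypus — no Heegner cycles, no factorials, no `3`-new level), obtain
`ch_{R_Iw}(X₂) ∣ (unit·𝓛₂)²·D₂` for the two-variable `(∅,0)`-Selmer module `X₂`, and DESCEND to the Steinberg line `𝔓`:
`μ(𝓛₂ mod 𝔓) = μ(L_𝔭^{BDP}(E′)) = 0` is the route's own analytic input (Hsieh Thm. B at any level, item `TwinHsiehThmBInput` BY NAME;
Castella 2018 [exceptional] Thm. 2.10: at the `3`-new point the specialisation acquires only the factor `(1 − a₃·χ(𝔭̄)⁻¹)`, an element
`1 − unit·γ` of `Λ^ur` with `μ = 0` — the exceptional zero is `μ`-NEUTRAL and lives in the Greenberg structure, not in `(∅,0)`: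
`Literature.Barriers.BirchSwinnertonDyer.ExceptionalZeroBarrierNarrow`), and the commutative-algebra lemma `SteinbergLineMuDescent` below
(a submodule of an elementary `Λ₂`-module whose elementary divisors have `μ`-free constant terms has `X/𝔓X` finitely generated over `ℤ₃` —
NO pseudo-nullity needed) plus `(∅,0)`-control at `𝔓` (exact under `E′(K_{∞,w})[3] = 0`, `ρ̄` irreducible) give
«`X_(∅,0)(E′/K_∞)` finitely generated over `ℤ₃`» = torsion ∧ `μ = 0` = bucket B of the crux (route receptacle
`UniversalToricDescentAcDualMuZero.isTorsion_and_exists_generator_of_finite_pTorsion`).  Bucket C₀ is the registered constant C₀′ BY NAME.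

WHY EASIER THAN THE LINE OF RECORD (named): K1‴ (a per-curve mod-3 indivisibility CERTIFICATE of the bottom Heegner class, no uniform proof
path; vet utdR3) is REPLACED by a theorem-shaped input — Hsieh's `μ = 0` on the line + the descent lemma; K2a‴ (Howard's KS machine for `E′` at
`3 ∥ N′`) is REPLACED by Fouquet Thm. A(iii) / Howard 2007 Thm. 3.2.3(c) over `R_Iw`, whose level hypotheses concern `M` (`3 ∤ M` ✓,
`3 ∤ φ(M)` = a bucket restriction / port) — the `3 ∣ N′` wall disappears; what remains are the GENERIC small-prime ports of `p`-adic modular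
form theory (`p ∤ 6`: `E_{p−1}`-lift of the Hasse invariant, Hida/Ohta control at `p = 3` with neat tame level) that every line at `p = 3`
faces anyway, and the Steinberg specialisation, crossed in the `(∅,0)` structure where it carries no zero.

PIECES (D-0171 tags; evidence and leaves in `Lines/steinberg_line_descent.md`):
* S_B `TwoVarDescentFgMultOfParamAtThree` / `stub_twoVarDescentMult` — bucket B in DESCENT CURRENCY («`X_(∅,0)(E′/K_∞)` at `𝔭′` is
  finitely generated over `ℤ₃`», the output shape of `SteinbergLineMuDescent` + control).  UNDECIDED · EQUIV to the bucket-B half of the crux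
  (both directions kernel-checked below: `twoVarFg_of_crux`, and the B-branch of `TwinAlgMuZeroAtThree_of`); WEAKER-OR-EQUAL than the line
  of record's pair K1‴ ∧ K2a‴ (`twoVarFg_of_betaRoad`).  Children: S1 «two-variable Howard divisibility over `R_Iw` at `p = 3`»
  UNDECIDED · port-of-print (Fouquet 2013 Thm. A(iii) `p > 3`, Howard 2007 Thm. 3.2.3 `p ∤ 6Mφ(M)`; Hyp. 1 = non-trivial homothety in the
  image, tree `p719731`-adjacent) · S2 «two-variable ERL `Log(loc_𝔭 𝔷_∞) = 𝓛₂` at `p = 3`» ATTACKABLE · port (Castella 2020 Thm. 4.4 via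
  Prop. 4.5 at weight-2 wild-character points; Ohta/Katz `Λ`-adic `d μ` at `p = 3`) · S3 «two-sided link over `R_Iw`:
  `ch(X₂) ∣ (E_𝔭·𝓛₂)²·D₂`» WEAKER · ATTACKABLE (Poitou–Tate bookkeeping BCK (A3)/(A4) one variable up) · S4 «`μ(𝓛₂ mod 𝔓) = 0`» =
  `TwinHsiehThmBInput` BY NAME (tree fact) + frame comparison Hsieh ↔ Castella/BDP at `p = 3` (item 20400's caveat) · ATTACKABLE ·
  M3 `SteinbergLineMuDescent` TYPED below · WEAKER · ATTACKABLE (commutative algebra over `Λ₂ = ℤ₃⟦T⟧⟦S⟧`) · S5 «`(∅,0)`-control at the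
  Steinberg fibre» ATTACKABLE (Mazur control; `E′(K_{∞,w})[3] = 0` at `𝔭′` très ramifié, `H⁰(K, E′[3]) = 0`).
* C₀′ `stub_goodSS` — the registered constant BY NAME · UNDECIDED (untouched by this line: `a₃ = 0` is not ordinary, no Hida family).
* `TwinAlgMuZeroAtThree_of` — the crux BY NAME from S_B and C₀′ (kernel-checked; bucket split + the route's `Λ`-module receptacle).

HONEST FRAMING: nothing is discharged; two `sorry`s (the two stubs) and nowhere else; `SteinbergLineMuDescent` is a `Prop` with no stub
(claimable as a plain theorem); crux 24737 stays OPEN; BSD is proved for no curve here.  Caveats carried on the card: Fouquet needs the branch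
`𝕀` regular (work over its normalisation), Howard 2007 needs `p ∤ φ(M)`, the exceptional point needs `𝔷_∞ mod 𝔓 ≠ 0`-free bookkeeping
(Castella 2018 [exceptional]: `loc_𝔭` of the specialised class vanishes only at the trivial character when `a₃ = +1`; the class itself is
non-torsion by Cornut–Vatsal in the family, Howard 2007 Cor. 3.1.2), `μ(D₂ mod 𝔓) = 0` for the local terms.
References: [Howard2007] = B. Howard, Invent. Math. 167 (2007) 91–128 (arXiv:1202.6358) Hyp. 1.0.1, Thm. 3.2.3, Cor. 3.1.2, Conj. 3.3.1;
[Fouquet2013] = O. Fouquet, Compos. Math. 149 (2013) 356–416, Thm. A; [Castella2020JIMJ] = arXiv:1410.6591 Thm. 4.4, Prop. 4.5;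
[Castella2018Exceptional] = arXiv:1507.04260 Thm. 2.10–2.11, §3; [Hsieh2014] Thm. B; [BCK21] = arXiv:1908.09512 (A3)–(A4);
[GreenbergVatsal2000] §2; R. Greenberg, «On the structure of Selmer groups» (2016) (no finite / pseudo-null submodules);
T. Ochiai, Compos. Math. 142 (2006) (Euler system for Galois deformations, specialisation of characteristic ideals).
-/

noncomputable section

open scoped Classical NumberField

set_option linter.dupNamespace false
set_option autoImplicit false

namespace Summit.BirchSwinnertonDyer.BirchSwinnertonDyer.Cruxes.TwinAlgMuZeroAtThree.SteinbergLineDescent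

open NumberField IsDedekindDomain Field WeierstrassCurve
open Literature.NumberTheory.EllipticCurves Literature.NumberTheory.EllipticCurves.IwasawaAlgebra
open Literature.NumberTheory.EllipticCurves.ZpExtension
open Summit.BirchSwinnertonDyer.Rank1Residual.X11b Summit.BirchSwinnertonDyer.Rank1Residual.X11b.AcSelmer
open Summit.BirchSwinnertonDyer.BirchSwinnertonDyer.Theorems
open Literature.NumberTheory.EllipticCurves.ModularForms (ModularParametrizationData)

/-! ## §1 The typed commutative-algebra leaf M3: `μ`-descent to a line inside an elementary two-variable module -/

/-- **M3 `SteinbergLineMuDescent`** (WEAKER · ATTACKABLE; pure commutative algebra, no arithmetic).  `Λ₂ = ℤ₃⟦T⟧⟦S⟧`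
(`IwasawaAlgebra₂ 3`: OUTER variable `S` = the weight variable of the Hida family, normalised so that the Steinberg line is `S = 0`;
INNER variable `T` = the anticyclotomic variable; reduction modulo `S` is `PowerSeries.constantCoeff` with values in `Λ = ℤ₃⟦T⟧`).
If a `Λ₂`-module `X` EMBEDS into an elementary module `⊕ᵢ Λ₂/(fᵢ)` whose elementary divisors have `μ`-FREE constant terms
(`3 ∤ fᵢ(T, 0)` in `Λ`), then `X/SX` is finitely generated over `ℤ₃` (= `Λ`-torsion with `μ = 0`).  Proof sketch: `E/SE = ⊕ Λ/(fᵢ(T,0))`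
is f.g. over `ℤ₃` (Weierstrass; tree `moduleFinite_padicInt_of_finite_quotient_augIdealP`), and the kernel of `X/SX → E/SE` is a quotient of
the `S`-torsion `C[S]` of `C = E/X`, whose support avoids the prime `(3, S)` because every `fᵢ` is a unit at it — so every composition
factor `Λ₂/𝔮` of `C[S]` is `Λ/(h)` with `h` distinguished or `𝔽₃`, f.g. over `ℤ₃`.  NO pseudo-nullity of the cokernel is needed (that
hypothesis enters only when one wants the EMBEDDING from «no non-zero pseudo-null submodule + `char = (∏ fᵢ)`», Bourbaki AC VII §4.4 Thm. 5,
which is how S1–S3 deliver the hypothesis).  [cite: GreenbergVatsal2000, §2 Prop. (2.8) (shape `μ = 0 ⟺` f.g. over `ℤ_p`)]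
[cite: Washington1997, §13.2] -/
@[conjecture]
def SteinbergLineMuDescent : Prop :=
  ∀ (n : ℕ) (f : Fin n → IwasawaAlgebra₂ 3)
    (X : Type) [AddCommGroup X] [Module (IwasawaAlgebra₂ 3) X]
    (φ : X →ₗ[IwasawaAlgebra₂ 3] ((i : Fin n) → (IwasawaAlgebra₂ 3 ⧸ Ideal.span {f i}))),
    Function.Injective φ →
    (∀ i, ¬ (3 : IwasawaAlgebra 3) ∣ PowerSeries.constantCoeff (f i)) →
    Module.Finite ℤ_[3] (RestrictScalars ℤ_[3] (IwasawaAlgebra₂ 3)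
      (X ⧸ (Ideal.span {(PowerSeries.X : IwasawaAlgebra₂ 3)} • (⊤ : Submodule (IwasawaAlgebra₂ 3) X))))

/-! ## §2 The bucket-B piece S_B in descent currency -/

/-- **S_B `TwoVarDescentFgMultOfParamAtThree`** — bucket B of crux 24737 in DESCENT CURRENCY: for every twin `W′/ℚ` multiplicative and
très ramifié at `3` (`3 ∤ v₃(Δ′)`) with `ρ̄₃` onto and conductor `N′`, GIVEN a modular parametrisation datum `Dt′`, every imaginary
quadratic `K` Heegner for `N′` with odd `d_K`, every anticyclotomic `κ` with topological generator `γ`, `𝔭 ∋ 3` of degree one and `𝔭′ ∋ 3`,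
`𝔭′ ≠ 𝔭`: Castella's compact `(∅,0)` Selmer module `X_(∅,0)(E′/K_∞)` at `𝔭′` is FINITELY GENERATED OVER `ℤ₃`.  The line intends:
`X = X₂/𝔓X₂` up to the (finite) control defect, `X₂` the two-variable module over `R_Iw`, f.g. over `ℤ₃` by `SteinbergLineMuDescent` fed
with Fouquet/Howard-2007 divisibility, Castella's two-variable reciprocity law and Hsieh's `μ = 0` (S1–S5 of the card).  UNDECIDED · EQUIV to
the B-half of the crux (`twoVarFg_of_crux` and `TwinAlgMuZeroAtThree_of`).  A `Prop` only; nothing is asserted.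
[cite: GreenbergVatsal2000, §2 Prop. (2.8)] [cite: Fouquet2013, Thm. A(iii)] [cite: Castella2020JIMJ, Thm. 4.4] -/
@[conjecture]
def TwoVarDescentFgMultOfParamAtThree : Prop :=
    ∀ (W' : WeierstrassCurve ℚ) [W'.IsElliptic] [W'.IsGloballyMinimal] (N' : ℕ) [NeZero N']
      (K : Type) [Field K] [NumberField K] (_Dt' : ModularParametrizationData W' N'),
      Rank1Residual.Mult W' 3 → ¬ 3 ∣ padicValInt 3 W'.minimalDiscriminantInt →
      W'.HasSurjectiveModNGaloisRep 3 → W'.conductorNorm ℤ = N' → IsImaginaryQuadratic K →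
      SatisfiesHeegnerHypothesis N' K → Odd (NumberField.discr K) →
      ∀ (κ : ZpExtension K 3), κ.IsAnticyclotomic →
      ∀ (γ : absoluteGaloisGroup K) [Fact (κ.IsTopGenerator γ)]
        (𝔭 : HeightOneSpectrum (𝓞 K)), ((3 : ℕ) : 𝓞 K) ∈ 𝔭.asIdeal →
        𝔭.asIdeal.ramificationIdx (𝓞 ℚ) = 1 → 𝔭.asIdeal.inertiaDeg (𝓞 ℚ) = 1 →
      ∀ (𝔭' : HeightOneSpectrum (𝓞 K)), ((3 : ℕ) : 𝓞 K) ∈ 𝔭'.asIdeal → 𝔭' ≠ 𝔭 →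
      Module.Finite ℤ_[3] (RestrictScalars ℤ_[3] (IwasawaAlgebra 3) (XAc (W'.baseChange K) 3 κ 𝔭' ∅ γ))

/-! ## §3 Evidence for the tags (no `sorry`): S_B ⟸ crux-B half, S_B ⟸ K1‴ ∧ K2a‴ -/

/-- **crux ⟹ S_B** (so S_B is a CONSEQUENCE of the crux: with the B-branch of `TwinAlgMuZeroAtThree_of` this makes S_B EQUIV to the
bucket-B half): torsion ∧ a generator of `Ch·R₀⟦T⟧` with a norm-one coefficient ⟹ `Sel[3]` finite ⟹ `X` f.g. over `ℤ₃` (route receptacle,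
both steps landed). [cite: Washington1997, §13.2] [cite: LimSujatha2018, §3] -/
theorem twoVarFg_of_crux
    (h : Summit.BirchSwinnertonDyer.BirchSwinnertonDyer.Theses.UniversalToricDescent.TwinAlgMuZeroAtThree) :
    TwoVarDescentFgMultOfParamAtThree := by
  intro W' _ _ N' _ K _ _ Dt' hm htr hsurj hN hK hH hodd κ hκ γ _ 𝔭 h𝔭 he hf 𝔭' h𝔭' hne
  obtain ⟨htors, g, hg, hi⟩ := h W' N' K Dt' (Or.inl ⟨hm, htr⟩) hsurj hN hK hH hodd κ hκ γ 𝔭 h𝔭 he hf 𝔭' h𝔭' hne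
  exact UniversalToricDescentAcDualMuZero.moduleFinite_padicInt_of_finite_pTorsion (W'.baseChange K) 3 κ 𝔭' ∅ γ Set.finite_empty
    (UniversalToricDescentAcDualMuZero.finite_pTorsion_of_isTorsion_of_exists_generator (W'.baseChange K) 3 κ 𝔭' ∅ γ
      Set.finite_empty htors ⟨g, hg, hi⟩)

/-- **K1‴ ∧ K2a‴ ⟹ S_B** (so S_B is no stronger than what line `beta-road` v19 already asks for bucket B): the landed bucket-B chain
`twinAlgMuZeroAtThree_mult_of_betaRoadParam` gives torsion and a generator with a norm-one coefficient; read it back as f.g. over `ℤ₃`.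
[cite: Howard2004HeegnerKolyvagin, Thm. 2.3.1 (shape only)] [cite: GreenbergVatsal2000, §2 Prop. (2.8)] -/
theorem twoVarFg_of_betaRoad
    (hK1 : UniversalToricDescentBetaRoadParamDefs.PrincipalHeegnerIndivisibleMultOfParamAtThree)
    (hK2 : UniversalToricDescentKsTwinLambdaDefs.KsTwinLambdaAdicAtThree) :
    TwoVarDescentFgMultOfParamAtThree := by
  intro W' _ _ N' _ K _ _ Dt' hm htr hsurj hN hK hH hodd κ hκ γ _ 𝔭 h𝔭 he hf 𝔭' h𝔭' hne
  obtain ⟨htors, g, hg, hμ⟩ :=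
    UniversalToricDescentTwinAlgMuZeroAtThreeOfBetaRoadParam.twinAlgMuZeroAtThree_mult_of_betaRoadParam hK1 hK2
      W' N' K Dt' hm htr hsurj hN hK hH hodd κ hκ γ 𝔭 h𝔭 he hf 𝔭' h𝔭' hne
  exact UniversalToricDescentAcDualMuZero.moduleFinite_padicInt_of_finite_pTorsion (W'.baseChange K) 3 κ 𝔭' ∅ γ Set.finite_empty
    (UniversalToricDescentAcDualMuZero.finite_pTorsion_of_isTorsion_of_exists_generator (W'.baseChange K) 3 κ 𝔭' ∅ γ
      Set.finite_empty htors ⟨g, hg, hμ⟩)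

/-! ## §4 The two stubs of the node (the ONLY `sorry`s of this file) -/

/-- **stub S_B** (`TwoVarDescentFgMultOfParamAtThree`) — UNDECIDED; research; children S1 (two-variable Howard divisibility over `R_Iw` at
`p = 3`), S2 (two-variable explicit reciprocity law at `p = 3`), S3 (two-sided link one variable up), S4 (`μ = 0` on the Steinberg line =
`TwinHsiehThmBInput` + frame comparison), M3 (`SteinbergLineMuDescent`, typed above), S5 (`(∅,0)`-control at `𝔓`) — see
`Lines/steinberg_line_descent.md`.  [cite: Fouquet2013, Thm. A(iii)] [cite: Howard2007, Thm. 3.2.3] [cite: Castella2020JIMJ, Thm. 4.4]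
[cite: Hsieh2014, Thm. B] -/
theorem stub_twoVarDescentMult : TwoVarDescentFgMultOfParamAtThree := by
  sorry

/-- **stub C₀′** — the registered good-supersingular constant of line `beta-road` v19 BY NAME (untouched by this line). -/
theorem stub_goodSS : UniversalToricDescentBetaRoadParamDefs.TwinAlgMuZeroAtThreeGoodSSOfParam := by
  sorry

/-! ## §5 Composition: the crux BY NAME -/

/-- **Crux 24737 `TwinAlgMuZeroAtThree` BY NAME from S_B and C₀′**: split the bucket disjunction; on B apply S_B and the route's receptacle
(`X` f.g. over `ℤ₃` ⟹ `Sel[3]` finite ⟹ torsion ∧ `Ch·R₀⟦T⟧ = (g)` with a norm-one coefficient, both steps landed in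
`UniversalToricDescentAcDualMuZeroCriterion`); on C₀ apply C₀′.  Kernel-checked; no `sorry`.
[cite: GreenbergVatsal2000, §2 Prop. (2.8)] [cite: Washington1997, §13.2] -/
theorem TwinAlgMuZeroAtThree_of (hB : TwoVarDescentFgMultOfParamAtThree)
    (hC0 : UniversalToricDescentBetaRoadParamDefs.TwinAlgMuZeroAtThreeGoodSSOfParam) :
    Summit.BirchSwinnertonDyer.BirchSwinnertonDyer.Theses.UniversalToricDescent.TwinAlgMuZeroAtThree := by
  intro W' _ _ N' _ K _ _ Dt' hbucket hsurj hN hK hH hodd κ hκ γ _ 𝔭 h𝔭 he hf 𝔭' h𝔭' hne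
  rcases hbucket with ⟨hm, htr⟩ | ⟨hss, ha⟩
  · have hfg := hB W' N' K Dt' hm htr hsurj hN hK hH hodd κ hκ γ 𝔭 h𝔭 he hf 𝔭' h𝔭' hne
    exact UniversalToricDescentAcDualMuZero.isTorsion_and_exists_generator_of_finite_pTorsion (W'.baseChange K) 3 κ 𝔭' ∅ γ
      Set.finite_empty
      (UniversalToricDescentAcDualMuZero.finite_pTorsion_of_moduleFinite_padicInt (W'.baseChange K) 3 κ 𝔭' ∅ γ hfg)
  · exact (UniversalToricDescentBetaRoadParamDefs.twinAlgMuZeroAtThreeGoodSSOfParam_iff.mp hC0)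
      W' N' K Dt' hss ha hsurj hN hK hH hodd κ hκ γ 𝔭 h𝔭 he hf 𝔭' h𝔭' hne

/-- **The node closes the crux from its two stubs** (= `TwinAlgMuZeroAtThree_of stub_twoVarDescentMult stub_goodSS`; inherits their
`sorry`s). -/
theorem TwinAlgMuZeroAtThree_of_stubs :
    Summit.BirchSwinnertonDyer.BirchSwinnertonDyer.Theses.UniversalToricDescent.TwinAlgMuZeroAtThree :=
  TwinAlgMuZeroAtThree_of stub_twoVarDescentMult stub_goodSS

/-- **And the line of record feeds this node**: K1‴ ∧ K2a‴ ∧ C₀′ ⟹ crux through S_B (sanity: the node is a re-cut, not a strengthening). -/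
theorem TwinAlgMuZeroAtThree_of_betaRoad_via_twoVarFg
    (hK1 : UniversalToricDescentBetaRoadParamDefs.PrincipalHeegnerIndivisibleMultOfParamAtThree)
    (hK2 : UniversalToricDescentKsTwinLambdaDefs.KsTwinLambdaAdicAtThree)
    (hC0 : UniversalToricDescentBetaRoadParamDefs.TwinAlgMuZeroAtThreeGoodSSOfParam) :
    Summit.BirchSwinnertonDyer.BirchSwinnertonDyer.Theses.UniversalToricDescent.TwinAlgMuZeroAtThree :=
  TwinAlgMuZeroAtThree_of (twoVarFg_of_betaRoad hK1 hK2) hC0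

end Summit.BirchSwinnertonDyer.BirchSwinnertonDyer.Cruxes.TwinAlgMuZeroAtThree.SteinbergLineDescent

end
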